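import Mathlib.NumberTheory.NumberField.Cyclotomic.PID
import Mathlib.NumberTheory.NumberField.Cyclotomic.Ideal
import Mathlib.Analysis.Real.Pi.Bounds
import HarnessLib

/-!
# `ℚ(ζ₁₅)` has class number one: `ℤ[ζ₁₅]` is a principal ideal domain

Topic `Literature/NumberTheory/NumberFields`, namespace `Literature.NumberTheory.NumberFields`.  Theorems only; no
definition, no named fact (net Literature debt 0).  Companion of `CyclotomicFieldsSevenNineClassNumber` (degree `6`),
`CyclotomicFieldElevenClassNumber` (degree `10`) and `CyclotomicFieldsEightSixteenClassNumber` (degrees `4`, `8`); here the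
first cyclotomic field of COMPOSITE conductor with two odd primes, `ℚ(ζ₁₅) = ℚ(ζ₃)ℚ(ζ₅)` of degree `8`, discriminant
`d = 3⁴ · 5⁶ = 1265625 = 1125²` (Washington Prop. 2.7 / Mathlib's `IsCyclotomicExtension.Rat.discr` for general `n`), an entry of
Masley–Montgomery's list (`h(ℚ(ζ_n)) = 1` iff `φ(n) ≤ 20` or `n ∈ {35, 45, 84}`; Washington Thm. 11.1).

The Minkowski constant is `M_K = (4/π)⁴ · (8!/8⁸) · 1125 ≈ 7.12 < 8` (with `π > 3.14`), so every ideal class contains an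
ideal of norm `≤ 7`, and Mathlib's Galois-case criterion
`RingOfIntegers.isPrincipalIdealRing_of_isPrincipal_of_lt_or_isPrincipal_of_mem_primesOver_of_mem_Icc` asks, for each prime
`p ≤ 7`, for a prime of `𝓞_K` above `p` with `p^f > 7` (or principal).  NO generator has to be exhibited: by the splitting law
in cyclotomic fields (Marcus Thm. 26 / Washington Thm. 2.13; Mathlib `inertiaDeg_eq_of_not_dvd` for `p ∤ 15` and
`inertiaDeg_eq` for `n = p^{k+1} m`) the residue degrees are `f(2) = ord₁₅(2) = 4` (`2⁴ = 16`), `f(3) = ord₅(3) = 4`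
(`3⁴ = 81`), `f(5) = ord₃(5) = 2` (`5² = 25`), `f(7) = ord₁₅(7) = 4` (`7⁴ = 2401`), all `> 7`.

* `discr_of_isCyclotomicExtension_fifteen` (`d = 1265625`), `minkowskiBound_lt_eight_of_isCyclotomicExtension_fifteen`
  (`M_K < 8`), **`classNumber_eq_one_of_isCyclotomicExtension_fifteen`** (`h(K) = 1` for every `15`-th cyclotomic
  extension `K/ℚ`), `isPrincipalIdealRing_adjoin_of_isPrimitiveRoot_fifteen` (`ℤ[ζ₁₅]` is a PID),
  `isPrincipalIdealRing_ringOfIntegers_cyclotomicField_fifteen`, `classNumber_cyclotomicField_fifteen`.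

Consumers: the lane's programme on complex `4`-tori with an endomorphism of characteristic polynomial `Φ₁₅` (isomorphism
classes need `h(ℚ(ζ₁₅)) = 1`).

## References

* [Washington1997] L. C. Washington, *Introduction to Cyclotomic Fields*, 2nd ed., GTM 83 (1997), Thm. 11.1
  (Masley–Montgomery), Prop. 2.7 (discriminant), Thm. 2.13 (splitting of primes).
* [Marcus2018] D. A. Marcus, *Number Fields*, 2nd ed. (2018), Ch. 3 Thm. 26 (chunk p0064), Ch. 5 Thm. 37 Cor. 2 (p0107).
* [MasleyMontgomery1976] J. M. Masley, H. L. Montgomery, *Cyclotomic fields with unique factorization*, J. reine angew.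
  Math. 286/287 (1976) 248–256.
-/

noncomputable section

namespace Literature.NumberTheory.NumberFields

open NumberField NumberField.InfinitePlace Polynomial Nat Real IsCyclotomicExtension.Rat Ideal
open scoped Real

section Fifteen

variable (K : Type) [Field K] [NumberField K] [IsCyclotomicExtension {15} ℚ K]

/-- **The discriminant of `ℚ(ζ₁₅)` is `3⁴ · 5⁶ = 1265625`** (`(−1)^{φ(15)/2} 15⁸ / (3^{8/2} 5^{8/4})`).
[cite: Washington1997, Prop. 2.7] -/
theorem discr_of_isCyclotomicExtension_fifteen : NumberField.discr K = 1265625 := by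
  have h := IsCyclotomicExtension.Rat.discr 15 K
  have hφ : Nat.totient 15 = 8 := by decide
  have hpf : (15 : ℕ).primeFactors = {3, 5} := by
    rw [show (15 : ℕ) = 3 * 5 from rfl, Nat.primeFactors_mul (by norm_num) (by norm_num),
      Nat.Prime.primeFactors Nat.prime_three, Nat.Prime.primeFactors Nat.prime_five]
    rfl
  rw [hφ, hpf, Finset.prod_pair (by norm_num)] at h
  rw [h]
  norm_num

/-- **The Minkowski constant of `ℚ(ζ₁₅)` is `< 8`**: `(4/π)⁴ · (8!/8⁸) · √1265625 < (4/3.14)⁴ · (315/131072) · 1125 < 8`.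
[cite: Marcus2018, Ch. 5 Thm. 37 Cor. 2 (p0107)] -/
theorem minkowskiBound_lt_eight_of_isCyclotomicExtension_fifteen :
    (4 / π) ^ nrComplexPlaces K * ((Module.finrank ℚ K)! / (Module.finrank ℚ K) ^ (Module.finrank ℚ K) *
      √|(NumberField.discr K : ℝ)|) < 8 := by
  rw [discr_of_isCyclotomicExtension_fifteen K, IsCyclotomicExtension.finrank (n := 15) K
    (cyclotomic.irreducible_rat (by norm_num)), nrComplexPlaces_eq_totient_div_two 15,
    show Nat.totient 15 = 8 by decide]
  have hπ : 4 / π < 4 / 3.14 := by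
    apply div_lt_div_of_pos_left (by norm_num) (by norm_num) pi_gt_d2
  have hπ0 : 0 ≤ 4 / π := by positivity
  have h4 : (4 / π) ^ (8 / 2) < (4 / 3.14 : ℝ) ^ (8 / 2) := by
    rw [show (8 / 2 : ℕ) = 4 by norm_num]
    gcongr
  have hsqrt : √|((1265625 : ℤ) : ℝ)| = 1125 := by
    rw [show |((1265625 : ℤ) : ℝ)| = 1125 ^ 2 by norm_num, Real.sqrt_sq (by norm_num)]
  have hfac : ((8 : ℕ)! : ℝ) / (8 : ℕ) ^ (8 : ℕ) = 315 / 131072 := by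
    rw [show (8 : ℕ)! = 40320 by rfl]
    norm_num
  rw [hfac, hsqrt]
  calc (4 / π) ^ (8 / 2) * (315 / 131072 * (1125 : ℝ))
      ≤ (4 / 3.14 : ℝ) ^ (8 / 2) * (315 / 131072 * 1125) := by
        gcongr
    _ < 8 := by norm_num

/-- `𝓞_K` is a principal ideal domain for a `15`-th cyclotomic extension `K/ℚ` (the Minkowski-bound argument; public
form: `classNumber_eq_one_of_isCyclotomicExtension_fifteen`). [cite: Marcus2018, Ch. 5 Thm. 37 Cor. 2 (p0107) and Ch. 3 Thm. 26 (p0064)] -/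
private theorem isPrincipalIdealRing_ringOfIntegers_fifteen_aux : IsPrincipalIdealRing (𝓞 K) := by
  -- Thm. 26 data (closed terms, before any `Fact (Nat.Prime _)` enters the context):
  -- `2` and `7` have order `4` modulo `15`; `3` has order `4` modulo `5`; `5` has order `2` modulo `3`
  have h2 : orderOf (2 : ZMod 15) = 4 :=
    (orderOf_eq_iff (by norm_num)).2 ⟨by decide, fun m hm h0 ↦ by interval_cases m <;> decide⟩
  have h7 : orderOf (7 : ZMod 15) = 4 :=
    (orderOf_eq_iff (by norm_num)).2 ⟨by decide, fun m hm h0 ↦ by interval_cases m <;> decide⟩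
  have h3 : orderOf (3 : ZMod 5) = 4 :=
    (orderOf_eq_iff (by norm_num)).2 ⟨by decide, fun m hm h0 ↦ by interval_cases m <;> decide⟩
  have h5 : orderOf (5 : ZMod 3) = 2 :=
    (orderOf_eq_iff (by norm_num)).2 ⟨by decide, fun m hm h0 ↦ by interval_cases m; decide⟩
  haveI : IsGalois ℚ K := IsCyclotomicExtension.isGalois {15} ℚ K
  have hM := minkowskiBound_lt_eight_of_isCyclotomicExtension_fifteen K
  have hfloor : ⌊(4 / π) ^ nrComplexPlaces K * ((Module.finrank ℚ K)! / (Module.finrank ℚ K) ^ (Module.finrank ℚ K) *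
      √|(NumberField.discr K : ℝ)|)⌋₊ ≤ 7 :=
    Nat.le_of_lt_succ ((Nat.floor_lt (by positivity)).2 hM)
  apply RingOfIntegers.isPrincipalIdealRing_of_isPrincipal_of_lt_or_isPrincipal_of_mem_primesOver_of_mem_Icc
  intro p hp hpp
  have hp7 : p ≤ 7 := (Finset.mem_Icc.1 hp).2.trans hfloor
  have hp2 : 2 ≤ p := hpp.two_le
  interval_cases p
  · -- `p = 2`: unramified, residue degree `ord₁₅(2) = 4`, `2⁴ = 16 > 7`
    haveI : Fact (Nat.Prime 2) := ⟨Nat.prime_two⟩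
    obtain ⟨⟨P, hP⟩⟩ := (Ideal.span {((2 : ℕ) : ℤ)}).nonempty_primesOver (S := 𝓞 K)
    refine ⟨P, hP, Or.inl ?_⟩
    haveI := hP.1
    haveI := hP.2
    rw [inertiaDeg_eq_of_not_dvd 2 K P (m := 15) (by norm_num), Nat.cast_ofNat, h2]
    omega
  · -- `p = 3`: `15 = 3¹ · 5`, residue degree `ord₅(3) = 4`, `3⁴ = 81 > 7`
    haveI : Fact (Nat.Prime 3) := ⟨Nat.prime_three⟩
    obtain ⟨⟨P, hP⟩⟩ := (Ideal.span {((3 : ℕ) : ℤ)}).nonempty_primesOver (S := 𝓞 K)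
    refine ⟨P, hP, Or.inl ?_⟩
    haveI := hP.1
    haveI := hP.2
    rw [inertiaDeg_eq 15 K P (p := 3) (k := 0) (m := 5) (by norm_num) (by norm_num), Nat.cast_ofNat, h3]
    omega
  · -- `p = 4` is not prime
    exact absurd hpp (by decide)
  · -- `p = 5`: `15 = 5¹ · 3`, residue degree `ord₃(5) = 2`, `5² = 25 > 7`
    haveI : Fact (Nat.Prime 5) := ⟨Nat.prime_five⟩
    obtain ⟨⟨P, hP⟩⟩ := (Ideal.span {((5 : ℕ) : ℤ)}).nonempty_primesOver (S := 𝓞 K)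
    refine ⟨P, hP, Or.inl ?_⟩
    haveI := hP.1
    haveI := hP.2
    rw [inertiaDeg_eq 15 K P (p := 5) (k := 0) (m := 3) (by norm_num) (by norm_num), Nat.cast_ofNat, h5]
    omega
  · -- `p = 6` is not prime
    exact absurd hpp (by decide)
  · -- `p = 7`: unramified, residue degree `ord₁₅(7) = 4`, `7⁴ = 2401 > 7`
    haveI : Fact (Nat.Prime 7) := ⟨Nat.prime_seven⟩
    obtain ⟨⟨P, hP⟩⟩ := (Ideal.span {((7 : ℕ) : ℤ)}).nonempty_primesOver (S := 𝓞 K)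
    refine ⟨P, hP, Or.inl ?_⟩
    haveI := hP.1
    haveI := hP.2
    rw [inertiaDeg_eq_of_not_dvd 7 K P (m := 15) (by norm_num), Nat.cast_ofNat, h7]
    omega

end Fifteen

/-! ### Class number one, for an arbitrary model `K` -/

/-- **EVERY `15`-TH CYCLOTOMIC EXTENSION `K/ℚ` HAS CLASS NUMBER ONE: `𝓞_K = ℤ[ζ₁₅]` is a principal ideal domain.**
Minkowski: every ideal class contains an ideal of norm `≤ 7`; by the splitting law the primes above `2, 3, 5, 7` have norms
`16, 81, 25, 2401`, so there is no ideal of norm `2, …, 7` other than `𝓞_K`-multiples and every class is trivial.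
[cite: Washington1997, Thm. 11.1 and Thm. 2.13] [cite: Marcus2018, Ch. 5 Thm. 37 Cor. 2 (p0107), Ch. 3 Thm. 26 (p0064)] -/
theorem classNumber_eq_one_of_isCyclotomicExtension_fifteen (K : Type) [Field K] [NumberField K]
    (hK : IsCyclotomicExtension {15} ℚ K) : classNumber K = 1 :=
  (classNumber_eq_one_iff (K := K)).2 (isPrincipalIdealRing_ringOfIntegers_fifteen_aux K)

/-- **`ℤ[ζ₁₅]` IS A PRINCIPAL IDEAL DOMAIN**: for every primitive `15`-th root of unity `ζ` of a `15`-th cyclotomic extension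
`K/ℚ`, the order `ℤ[ζ]` (`= 𝓞_K`, Mathlib `IsPrimitiveRoot.adjoinEquivRingOfIntegers`) is a principal ideal ring.
[cite: Washington1997, Thm. 11.1] [cite: MasleyMontgomery1976, Main Theorem] -/
theorem isPrincipalIdealRing_adjoin_of_isPrimitiveRoot_fifteen {K : Type} [Field K] [NumberField K]
    [IsCyclotomicExtension {15} ℚ K] {ζ : K} (hζ : IsPrimitiveRoot ζ 15) :
    IsPrincipalIdealRing (Algebra.adjoin ℤ ({ζ} : Set K)) :=
  haveI := isPrincipalIdealRing_ringOfIntegers_fifteen_aux K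
  IsPrincipalIdealRing.of_surjective hζ.adjoinEquivRingOfIntegers.symm hζ.adjoinEquivRingOfIntegers.symm.surjective

/-! ### Mathlib's model `CyclotomicField 15 ℚ` -/

/-- `CyclotomicField 15 ℚ` is a `15`-th cyclotomic extension of `ℚ` (Mathlib instance, recorded as a term). [folklore] -/
private theorem isCyclotomicExtension_cyclotomicField_fifteen : IsCyclotomicExtension {15} ℚ (CyclotomicField 15 ℚ) :=
  CyclotomicField.isCyclotomicExtension 15 ℚ

/-- **The ring of integers of `CyclotomicField 15 ℚ` (`= ℤ[ζ₁₅]`) is a principal ideal domain.** [cite: Washington1997, Thm. 11.1]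
[cite: MasleyMontgomery1976, Main Theorem] -/
theorem isPrincipalIdealRing_ringOfIntegers_cyclotomicField_fifteen :
    IsPrincipalIdealRing (𝓞 (CyclotomicField 15 ℚ)) :=
  haveI := isCyclotomicExtension_cyclotomicField_fifteen
  isPrincipalIdealRing_ringOfIntegers_fifteen_aux (CyclotomicField 15 ℚ)

/-- **`h(ℚ(ζ₁₅)) = 1`.** [cite: Washington1997, Thm. 11.1] [cite: MasleyMontgomery1976, Main Theorem] -/
theorem classNumber_cyclotomicField_fifteen : classNumber (CyclotomicField 15 ℚ) = 1 :=
  (classNumber_eq_one_iff (K := CyclotomicField 15 ℚ)).2 isPrincipalIdealRing_ringOfIntegers_cyclotomicField_fifteen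

end Literature.NumberTheory.NumberFields

end
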